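import Mathlib
import Summits.NavierStokesRegularity.NavierStokesRegularity.Theorems.LevelSetModerationHighSpeedPressureWorkFastSetGradientBricks

/-!
# Route LevelSetModeration — `HighSpeedPressureWork`: the fast-set speed-gradient bound, unit form

Support file for item stmt-NavierStokesRegularity-18149 (`HighSpeedPressureWork`), line
`iso-speed-area-closure`, stub `stub_earlyBookkeeping` (the margin-zero early law, the only debt
of the crux that is not the class-uniform speed bound, `…CruxAnatomy.lean`). The early stub lives
at levels `c ↓ sup|u₀| = B₀` and times `τ ↓ 0`, where the rigorous class-uniform gradient rate is
parabolic, `‖∇u(τ)‖ ≤ C B₀/√(ντ)` (`earlyBookkeeping_norm_fderiv_le`, p165554). This file proves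
that ON THE FAST SET `{|u(τ)| > B₀}` the gradient of the SPEED is logarithmic instead:

  `‖∇|u|(τ, x)‖ ≤ A (B₀²/ν) √(1 + log(ν/(B₀² τ)))`  whenever `‖u(τ,x)‖ > B₀`, `0 < τ ≤ ε ν/B₀²`

(`levelSetModeration_fastSetGradient`; unit form `levelSetModeration_fastSetGradient_unit`,
scale-invariant form under a speed bound `levelSetModeration_fastSetGradient_of_speed_le`).

Mechanism (all bricks landed): the mild formula from `s = τ/2`
(`mild_of_bounded_of_eLpNorm_two_le_of_lt`), `u(τ) = e^{(τ-s)Δ}u(s) − B_s(u,u)(τ)`; at a fast point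
`x` freeze the unit vector `e = u(τ,x)/|u(τ,x)|`, so that `∇|u|(τ,·)(x) = e·∇u(τ,x)` (Fermat:
`|u| − e·u ≥ 0` vanishes at `x`). The caloric part `e·e^{(τ-s)Δ}u(s) = B_s' − e^{(τ-s)Δ}g`,
`g = B_s' − e·u(s) ∈ [0, 2B_s']`, `B_s' = B₀ + C√(s)` the overshoot bound at time `s`
(`exists_norm_le_initial_add_of_classical_unit`), has at `x` the small value
`e^{(τ-s)Δ}g(x) ≤ (B_s' − B₀) + ‖B_s(u,u)(τ,x)‖ ≲ √τ` (fastness + `exists_norm_oseenDuhamel_le_mul`),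
so HAMILTON's logarithmic gradient estimate (`norm_fderiv_heatExtension_le_mul_sqrt_log`,
p166134) bounds `‖∇e^{(τ-s)Δ}g(x)‖ ≲ √τ · √(log(1/τ)/τ) = √(log(1/τ))`; the Duhamel part has a
bounded gradient, `‖∇B_s(u,u)(τ)‖ ≲ ∫ₛ^τ (τ−σ)^{-1/2} ‖∇u(σ)‖ dσ ≲ 1`
(`norm_fderiv_oseenDuhamel_le`, `fderiv_oseenSlice_apply_of_contDiff`, the early gradient rate).
This improves the rigorous ceiling on fast-set speed gradients at margin zero from `τ^{-1/4}`
(Li–Yau/Bernstein flatness) to `√(log(1/τ))`.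

This second file proves the unit form `levelSetModeration_fastSetGradient_unit` (`ν = 1`, speed
`≤ 1`); bricks in `…FastSetGradientBricks.lean`, scaled and class forms in `…FastSetGradient.lean`.
-/

noncomputable section

-- single-conjunct summit: `Summit.<Summit>.<Problem>` repeats the name by the D-0017 layout
set_option linter.dupNamespace false

namespace Summit.NavierStokesRegularity.NavierStokesRegularity.Theorems

open MeasureTheory Set Filter Topology Function
open scoped ENNReal RealInnerProductSpace
open Literature.Analysis.FluidPDE
open Literature.Analysis.UnboundedOperators (heatExtension heatKernel heatExtension_apply
  heatKernel_pos integrable_heatKernel_holds integral_heatKernel_eq_one_holds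
  integrable_heatKernel_smul_of_bound norm_fderiv_heatExtension_le_mul_sqrt_log
  contDiff_heatExtension_holds memLp_top_of_continuous_of_bound)

/-! ### The fast-set speed-gradient bound, unit form -/

set_option maxHeartbeats 400000 in
/-- **Fast-set speed-gradient bound, unit form** (`ν = 1`, speed `≤ 1`): there are absolute
`A ≥ 0` and `ε > 0` such that for every classical solution of the unforced Navier–Stokes system
on `ℝ³ × [0, b)` with `‖u‖ ≤ 1` on `[0, T] × ℝ³` (`T < b`), `‖u(t)‖_{L²} ≤ K < ∞` there, and
`‖u(0, ·)‖ ≤ B` with `0 < B ≤ 1`: at every time `t ∈ (0, T)` with `t ≤ ε B²` and every point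
`x` of the fast set `{‖u(t)‖ > B}`,

  `‖∇‖u(t, ·)‖(x)‖ ≤ A √(1 + log (B²/t))`.

(Mild formula from `s = t/2`, frozen direction `e = u(t,x)/‖u(t,x)‖`, Hamilton's logarithmic
gradient estimate for the caloric part `e^{(t-s)Δ}(B_s − e·u(s))` whose value at `x` is
`≲ √t` by fastness, the overshoot bound and the Duhamel sup bound, and the bounded Duhamel
gradient.) [folklore] -/
theorem levelSetModeration_fastSetGradient_unit :
    ∃ A ε : ℝ, 0 ≤ A ∧ 0 < ε ∧ ∀ {b T B : ℝ} {u : ℝ → EuclideanSpace ℝ (Fin 3) → EuclideanSpace ℝ (Fin 3)} {p : ℝ → EuclideanSpace ℝ (Fin 3) → ℝ}, Literature.Analysis.FluidPDE.IsClassicalNSSolutionOn (Set.Ico 0 b) 1 0 u p → 0 < T → T < b → (∀ t ∈ Set.Icc 0 T, ∀ x, ‖u t x‖ ≤ 1) → ∀ {K : ENNReal}, K ≠ ⊤ → (∀ t ∈ Set.Icc 0 T, MeasureTheory.eLpNorm (u t) 2 MeasureTheory.volume ≤ K) → 0 < B → B ≤ 1 → (∀ x, ‖u 0 x‖ ≤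 B) → ∀ t ∈ Set.Ioo 0 T, t ≤ ε * B ^ 2 → ∀ x, B < ‖u t x‖ → ‖fderiv ℝ (fun y => ‖u t y‖) x‖ ≤ A * Real.sqrt (1 + Real.log (B ^ 2 / t)) := by
  obtain ⟨C₃, hC₃, hover⟩ := exists_norm_le_initial_add_of_classical_unit
  obtain ⟨CD, hCD, hDuh⟩ := exists_norm_oseenDuhamel_le_mul (E := EuclideanSpace ℝ (Fin 3))
  obtain ⟨P, hP0, hPD⟩ := levelSetModeration_norm_fderiv_oseenDuhamel_le_unit
  set C' : ℝ := C₃ + 2 * CD with hC'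
  have hC'0 : 0 < C' := by rw [hC']; positivity
  set K₁ : ℝ := 1 + |Real.log (4 / C')| with hK₁
  have hK₁1 : 1 ≤ K₁ := by rw [hK₁]; linarith [abs_nonneg (Real.log (4 / C'))]
  set A : ℝ := 2 * Real.sqrt 2 * C' * Real.sqrt K₁ + P with hA
  set ε : ℝ := min 1 (1 / C' ^ 2) with hε
  have hε0 : 0 < ε := lt_min one_pos (by positivity)
  refine ⟨A, ε, by positivity, hε0, ?_⟩
  intro b T B u p hcl hT hTb hbd K hK hL2 hB hB1 hB0 t ht htε x hfast
  -- the window: `t ≤ B² ≤ 1` and `C'√t ≤ B`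
  have htB : t ≤ B ^ 2 := htε.trans ((mul_le_of_le_one_left (sq_nonneg B) (min_le_left _ _)))
  have ht1 : t ≤ 1 := htB.trans (by nlinarith)
  have hC't : C' * Real.sqrt t ≤ B := by
    have h1 : t ≤ 1 / C' ^ 2 * B ^ 2 := htε.trans (mul_le_mul_of_nonneg_right (min_le_right _ _)
      (sq_nonneg B))
    have h2 : C' ^ 2 * t ≤ B ^ 2 := by
      calc C' ^ 2 * t ≤ C' ^ 2 * (1 / C' ^ 2 * B ^ 2) := mul_le_mul_of_nonneg_left h1 (sq_nonneg _)
        _ = B ^ 2 := by field_simp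
    have h3 : Real.sqrt (C' ^ 2 * t) ≤ Real.sqrt (B ^ 2) := Real.sqrt_le_sqrt h2
    rwa [Real.sqrt_mul (sq_nonneg _), Real.sqrt_sq hC'0.le, Real.sqrt_sq hB.le] at h3
  -- times
  set s : ℝ := t / 2 with hs_def
  have hs : 0 < s := by rw [hs_def]; linarith [ht.1]
  have hst : s < t := by rw [hs_def]; linarith [ht.1]
  have hsT : s < T := hst.trans ht.2
  have hts : t - s = s := by rw [hs_def]; ring
  have hts0 : 0 < t - s := by rw [hts]; exact hs
  have hsqt : 0 < Real.sqrt t := Real.sqrt_pos.2 ht.1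
  have hss : Real.sqrt s ≤ Real.sqrt t := Real.sqrt_le_sqrt hst.le
  have htss : Real.sqrt (t - s) ≤ Real.sqrt t := by rw [hts]; exact hss
  -- restrictions of the hypotheses
  have hcl' : IsClassicalNSSolutionOn (Ioo 0 b) 1 0 u p :=
    hcl.mono Ioo_subset_Ico_self (uniqueDiffOn_Ioo 0 b)
  have hbd' : ∀ τ ∈ Ioc 0 T, ∀ y, ‖u τ y‖ ≤ 1 := fun τ hτ y => hbd τ ⟨hτ.1.le, hτ.2⟩ y
  have hL2' : ∀ τ ∈ Ioc 0 T, eLpNorm (u τ) 2 volume ≤ K := fun τ hτ => hL2 τ ⟨hτ.1.le, hτ.2⟩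
  -- (1) the mild formula from `s` at every point
  have hmild : ∀ y, u t y = heatExtension (u s) (t - s) y - oseenDuhamel 1 s u u t y := fun y =>
    mild_of_bounded_of_eLpNorm_two_le_of_lt hcl' hT hTb hbd' hK hL2' hs hst ht.2 y
  -- (2) the overshoot bound at time `s`
  set Bs : ℝ := B + C₃ * Real.sqrt s with hBs
  have hBBs : B ≤ Bs := by rw [hBs]; linarith [mul_nonneg hC₃.le (Real.sqrt_nonneg s)]
  have hBs0 : 0 < Bs := hB.trans_le hBBs
  have hus : ∀ y, ‖u s y‖ ≤ Bs := by
    intro y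
    have := hover hcl hT hTb hbd hK hL2' hB0 s ⟨hs, hsT⟩ y
    rwa [sub_zero] at this
  -- (3) the Duhamel sup bound
  have hbdI : ∀ τ ∈ Ioo s t, ∀ y, ‖u τ y‖ ≤ 1 := fun τ hτ y =>
    hbd τ ⟨(hs.trans hτ.1).le, (hτ.2.trans ht.2).le⟩ y
  have hduh : ∀ y, ‖oseenDuhamel 1 s u u t y‖ ≤ 2 * CD * Real.sqrt (t - s) := by
    intro y
    have h := hDuh one_pos hst zero_le_one zero_le_one hbdI hbdI y
    rw [Real.one_rpow] at h
    linarith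
  -- (4) the frozen direction
  have hux : 0 < ‖u t x‖ := hB.trans hfast
  have hux0 : u t x ≠ 0 := norm_pos_iff.1 hux
  set e : EuclideanSpace ℝ (Fin 3) := ‖u t x‖⁻¹ • u t x with he
  have hen : ‖e‖ = 1 := by rw [he, norm_smul, norm_inv, norm_norm, inv_mul_cancel₀ hux.ne']
  have hex : ⟪e, u t x⟫ = ‖u t x‖ := by
    rw [he, real_inner_smul_left, real_inner_self_eq_norm_sq]
    field_simp
  -- (5) the scalar datum `g = Bs − ⟪e, u(s)⟫ ∈ [0, 2Bs]`
  set g : EuclideanSpace ℝ (Fin 3) → ℝ := fun y => Bs - ⟪e, u s y⟫ with hg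
  have hcont_s : Continuous (u s) := (hcl'.contDiff_velocity ⟨hs, hsT.trans hTb⟩).continuous
  have hgc : Continuous g := continuous_const.sub (continuous_const.inner hcont_s)
  have hinner_le : ∀ y, |⟪e, u s y⟫| ≤ Bs := fun y =>
    (abs_real_inner_le_norm e (u s y)).trans (by rw [hen, one_mul]; exact hus y)
  have hg0 : ∀ y, 0 ≤ g y := fun y => by
    have := (le_abs_self _).trans (hinner_le y)
    simp only [hg]; linarith
  have hgM : ∀ y, g y ≤ 2 * Bs := fun y => by
    have h2 : -Bs ≤ ⟪e, u s y⟫ := (neg_le_neg (hinner_le y)).trans (neg_abs_le _)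
    simp only [hg]; linarith
  -- (6) the caloric part and its affine image
  set H : EuclideanSpace ℝ (Fin 3) → EuclideanSpace ℝ (Fin 3) := heatExtension (u s) (t - s) with hH
  have hgH : heatExtension g (t - s) = fun z => Bs - ⟪e, H z⟫ := by
    funext z
    rw [hH]
    exact heatExtension_const_sub_inner hcont_s hus Bs e hts0 z
  -- (7) the value at the fast point: `e^{(t-s)Δ}g(x) ≤ C'√t`
  set V₀ : ℝ := C' * Real.sqrt t with hV₀
  have hV₀pos : 0 < V₀ := by rw [hV₀]; positivity
  have hval : heatExtension g (t - s) x ≤ V₀ := by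
    have hHx : H x = u t x + oseenDuhamel 1 s u u t x := by
      rw [hH, hmild x]; abel
    have h1 : heatExtension g (t - s) x = Bs - ‖u t x‖ - ⟪e, oseenDuhamel 1 s u u t x⟫ := by
      rw [hgH]
      simp only [hHx, inner_add_right, hex]
      ring
    have h2 : -⟪e, oseenDuhamel 1 s u u t x⟫ ≤ 2 * CD * Real.sqrt (t - s) := by
      have := abs_real_inner_le_norm e (oseenDuhamel 1 s u u t x)
      rw [hen, one_mul] at this
      linarith [neg_abs_le ⟪e, oseenDuhamel 1 s u u t x⟫, hduh x]
    rw [h1]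
    calc Bs - ‖u t x‖ - ⟪e, oseenDuhamel 1 s u u t x⟫
        ≤ (B + C₃ * Real.sqrt s) - B + 2 * CD * Real.sqrt (t - s) := by rw [hBs]; linarith
      _ ≤ C₃ * Real.sqrt t + 2 * CD * Real.sqrt t := by
          have := mul_le_mul_of_nonneg_left hss hC₃.le
          have := mul_le_mul_of_nonneg_left htss (by positivity : (0 : ℝ) ≤ 2 * CD)
          linarith
      _ = V₀ := by rw [hV₀, hC']; ring
  have hV₀M : V₀ ≤ 2 * Bs := by
    rw [hV₀]
    linarith [hC't]
  -- (8) Hamilton's logarithmic gradient estimate for the caloric part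
  have hHam := norm_fderiv_heatExtension_le_mul_sqrt_log hgc hg0 hgM hts0 x hV₀pos hV₀M hval
  -- (9) differentiability of the pieces
  have hHd : Differentiable ℝ H := by
    rw [hH]
    exact (contDiff_heatExtension_holds (memLp_top_of_continuous_of_bound hcont_s hus) le_top
      hts0).differentiable (by simp)
  obtain ⟨hDd, hDn⟩ := hPD hcl' hT hTb hbd' hK hL2' t ht ht1 x
  have hut : Differentiable ℝ (u t) :=
    (hcl'.contDiff_velocity ⟨ht.1, ht.2.trans hTb⟩).differentiable (by simp)
  -- (10) the derivative of the speed at `x`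
  have hDnorm := fastSet_fderiv_norm_eq (hut x) hux0
  have hfun : u t = fun y => H y - oseenDuhamel 1 (t / 2) u u t y := by
    funext y; rw [hmild y, hH]
  have hDu : fderiv ℝ (u t) x = fderiv ℝ H x - fderiv ℝ (fun y => oseenDuhamel 1 (t / 2) u u t y) x := by
    rw [hfun]
    exact fderiv_fun_sub (hHd x) hDd.differentiableAt
  have hDinner : (innerSL ℝ e).comp (fderiv ℝ H x) = -fderiv ℝ (heatExtension g (t - s)) x := by
    have h1 : HasFDerivAt (fun z => ⟪e, H z⟫) ((innerSL ℝ e).comp (fderiv ℝ H x)) x := by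
      have := (innerSL ℝ e).hasFDerivAt.comp x (hHd x).hasFDerivAt
      simpa [Function.comp_def] using this
    have h2 : HasFDerivAt (heatExtension g (t - s)) (-((innerSL ℝ e).comp (fderiv ℝ H x))) x := by
      rw [hgH]
      exact h1.const_sub Bs
    rw [h2.fderiv, neg_neg]
  have hkey : fderiv ℝ (fun y => ‖u t y‖) x =
      -fderiv ℝ (heatExtension g (t - s)) x -
        (innerSL ℝ e).comp (fderiv ℝ (fun y => oseenDuhamel 1 (t / 2) u u t y) x) := by
    rw [hDnorm, ← he, hDu, ContinuousLinearMap.comp_sub, hDinner]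
  -- (11) the two norms
  have hn1 : ‖(innerSL ℝ e).comp (fderiv ℝ (fun y => oseenDuhamel 1 (t / 2) u u t y) x)‖ ≤ P := by
    refine (ContinuousLinearMap.opNorm_comp_le _ _).trans ?_
    rw [innerSL_apply_norm, hen, one_mul]
    exact hDn
  have hnorm : ‖fderiv ℝ (fun y => ‖u t y‖) x‖ ≤
      2 * V₀ * Real.sqrt ((1 + Real.log (2 * Bs / V₀)) / (t - s)) + P := by
    rw [hkey]
    refine (norm_sub_le _ _).trans (add_le_add ?_ hn1)
    rw [norm_neg]
    exact hHam
  -- (12) the final algebra: `2 V₀ √((1 + log(2Bs/V₀))/(t/2)) ≤ 2√2 C' √K₁ √(1 + log(B²/t))`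
  have hL0 : 0 ≤ Real.log (B ^ 2 / t) := Real.log_nonneg ((one_le_div ht.1).2 htB)
  set L : ℝ := Real.log (B ^ 2 / t) with hL
  have hBs2 : 2 * Bs ≤ 4 * B := by
    -- `C₃ √s ≤ C' √t ≤ B`
    have h1 : C₃ * Real.sqrt s ≤ C' * Real.sqrt t := by
      calc C₃ * Real.sqrt s ≤ C₃ * Real.sqrt t := mul_le_mul_of_nonneg_left hss hC₃.le
        _ ≤ C' * Real.sqrt t := by
            rw [hC']; nlinarith [hsqt.le, hCD.le]
    rw [hBs]; linarith
  have hlogle : Real.log (2 * Bs / V₀) ≤ Real.log (4 / C') + L / 2 := by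
    have h1 : 2 * Bs / V₀ ≤ 4 * B / V₀ := div_le_div_of_nonneg_right hBs2 hV₀pos.le
    have h2 : Real.log (2 * Bs / V₀) ≤ Real.log (4 * B / V₀) :=
      Real.log_le_log (div_pos (by linarith) hV₀pos) h1
    have h3 : 4 * B / V₀ = 4 / C' * Real.sqrt (B ^ 2 / t) := by
      rw [hV₀, Real.sqrt_div (sq_nonneg B), Real.sqrt_sq hB.le]
      field_simp
    have hBt : 0 < B ^ 2 / t := div_pos (pow_pos hB 2) ht.1
    have h4 : Real.log (4 * B / V₀) = Real.log (4 / C') + L / 2 := by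
      rw [h3, Real.log_mul (div_pos (by norm_num) hC'0).ne' (Real.sqrt_pos.2 hBt).ne',
        Real.log_sqrt hBt.le, hL]
    linarith
  have hX : 1 + Real.log (2 * Bs / V₀) ≤ K₁ * (1 + L) := by
    have h1 : Real.log (4 / C') ≤ |Real.log (4 / C')| := le_abs_self _
    have h2 : 0 ≤ |Real.log (4 / C')| * L := mul_nonneg (abs_nonneg _) hL0
    have h3 : K₁ * (1 + L) = 1 + |Real.log (4 / C')| + L + |Real.log (4 / C')| * L := by
      rw [hK₁]; ring
    rw [h3]
    linarith
  have hX0 : 0 ≤ 1 + Real.log (2 * Bs / V₀) := by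
    have : 0 ≤ Real.log (2 * Bs / V₀) := Real.log_nonneg ((one_le_div hV₀pos).2 hV₀M)
    linarith
  have hmain : 2 * V₀ * Real.sqrt ((1 + Real.log (2 * Bs / V₀)) / (t - s)) ≤
      2 * Real.sqrt 2 * C' * Real.sqrt K₁ * Real.sqrt (1 + L) := by
    rw [hts, hs_def, Real.sqrt_div hX0, hV₀]
    have hsq2 : Real.sqrt (t / 2) = Real.sqrt t / Real.sqrt 2 := Real.sqrt_div ht.1.le 2
    rw [hsq2]
    have h1 : Real.sqrt (1 + Real.log (2 * Bs / (C' * Real.sqrt t))) ≤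
        Real.sqrt K₁ * Real.sqrt (1 + L) := by
      rw [← Real.sqrt_mul (by linarith)]
      exact Real.sqrt_le_sqrt hX
    have h2 : 0 < Real.sqrt 2 := Real.sqrt_pos.2 (by norm_num)
    calc 2 * (C' * Real.sqrt t) * (Real.sqrt (1 + Real.log (2 * Bs / (C' * Real.sqrt t))) /
          (Real.sqrt t / Real.sqrt 2))
        = 2 * Real.sqrt 2 * C' * Real.sqrt (1 + Real.log (2 * Bs / (C' * Real.sqrt t))) := by
          field_simp
      _ ≤ 2 * Real.sqrt 2 * C' * (Real.sqrt K₁ * Real.sqrt (1 + L)) :=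
          mul_le_mul_of_nonneg_left h1 (by positivity)
      _ = _ := by ring
  have hsq1 : 1 ≤ Real.sqrt (1 + L) :=
    calc (1 : ℝ) = Real.sqrt 1 := Real.sqrt_one.symm
      _ ≤ Real.sqrt (1 + L) := Real.sqrt_le_sqrt (by linarith)
  calc ‖fderiv ℝ (fun y => ‖u t y‖) x‖
      ≤ 2 * V₀ * Real.sqrt ((1 + Real.log (2 * Bs / V₀)) / (t - s)) + P := hnorm
    _ ≤ 2 * Real.sqrt 2 * C' * Real.sqrt K₁ * Real.sqrt (1 + L) + P * Real.sqrt (1 + L) := by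
        have : P ≤ P * Real.sqrt (1 + L) := le_mul_of_one_le_right hP0 hsq1
        linarith
    _ = A * Real.sqrt (1 + L) := by rw [hA]; ring

end Summit.NavierStokesRegularity.NavierStokesRegularity.Theorems

end
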